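import Mathlib
import HarnessLib

/-!
# Fischler's family `𝒥(p)` of 5-fold integrals: the finiteness criterion (Fischler 2002, §3)

Typed, cited statement (no proof) from S. Fischler, « Formes linéaires en polyzêtas et intégrales multiples »,
C. R. Acad. Sci. Paris, Sér. I **335** (2002) 1–4 = arXiv:math/0202064 [Fischler2002Polyzetas], §3 « Une généralisation du
groupe de Rhin-Viola », specialised to `n = 5` (proofs: S. Fischler, *Groupes de Rhin-Viola et intégrales
multiples*, J. Théor. Nombres Bordeaux **15** (2003) 479–534, doi:10.5802/jtnb.411).  PRIMARY SOURCE read on the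
page (arXiv text, p. 4; Vasilyev's `δ_k` from p. 2), quoted: « À tout p = (a_1,…,a_n,b_1,…,b_n,c_2,…,c_n) ∈ ℤ^{3n−1}
on associe 𝒥(p) = ∫_{[0,1]^n} ∏_{k=1}^n x_k^{a_k}(1−x_k)^{b_k} / ∏_{k=2}^n δ_k(x)^{c_k} · dx_1…dx_n / δ_n(x) », with
« δ_k(x_1,…,x_n) = 1 − x_k δ_{k−1}(x_1,…,x_n) pour n ≥ 2 et k ∈ {1,…,n} avec δ_0 = 1 »; « On pose ρ_n = c_n − b_n et
ρ_{n−1} = c_{n−1} − 1 − b_{n−1}, puis ρ_k = ρ⁺_{k+2} + c_k − 1 − b_k pour tout k ∈ {1,…,n−2} en notant α⁺ = max(α,0)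
et avec la convention c_1 = 1. Alors l'intégrale 𝒥(p) est finie si et seulement si on a a_k ≥ 0, b_k ≥ 0 et
ρ_k ≤ a_{k−1} pour tout k ∈ {1,…,n}, avec la convention a_0 = 0. »  (Same page: « des changements de variables
montrent qu'on a 𝒥(p) = 𝒥(σ(p)) = 𝒥(ψ(p)) pour tout p » — these two invariances are PROVED tree-side in
`Summits/KontsevichZagierPeriods/Zeta5Search/SorokinCensus/Generalized.lean` (`sigmaIdentity_holds`,
`reversalIdentity_holds`) and are therefore not restated as facts.)

Rendering: `x : Fin 5 → ℝ` with `x_k = x (k-1)`; the recursion `δ_k` unrolled for `n = 5` (`delta1 … delta5`);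
parameters `a b : Fin 5 → ℤ` (`a (k-1) = a_k`), `c : Fin 4 → ℤ` (`c i = c_{i+2}`); « finie » = Lebesgue-integrable on
the closed cube `[0,1]^5` (the integrand is a.e. positive; boundary and junk values of `zpow` at poles are null sets).
Cell pub-zeta5 (HONEST FRAMING: systematic search; no irrationality claim unless certified): this family IS the
generalized Sorokin family `J₅^gen` of `…/SorokinCensus/Generalized.lean` (dictionary `GenPoint.toFischler` there);
the fact `integralJ_finite_iff` closes that file's node `ConvergenceCriterion` (`convergenceCriterion_of_fischler`).
Topic `Literature/NumberTheory/Irrationality/Fischler2002`. Staged 2026-08-21 by the cell pub-zeta5 fam-sorokin g4 seat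
(planner; filed by the lead/lit g12 lane after reading arXiv:math/0202064 p. 4 ll. 4–18 against this statement:
integrand, `δ_k` unrolling, `ρ_k` recursion with `c₁ = 1`, conditions `ρ_k ≤ a_{k−1}` with `a₀ = 0` all match; lane edits = bib keys
`Fischler2002Polyzetas`/`Fischler2003RhinViola` and the TODO line below, nothing else). -/

-- TODO(general form): Fischler states the criterion for every `n ≥ 2` (p ∈ ℤ^{3n−1}); only the case `n = 5` used by
-- the cell is vendored here.

namespace Literature.NumberTheory.Irrationality.Fischler2002

open MeasureTheory Set Finset

/-- Vasilyev's `δ₁ = 1 − x₁` (`δ_k = 1 − x_k δ_{k−1}`, `δ₀ = 1`). [cite: Fischler2002Polyzetas, §1 p. 2] -/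
noncomputable def delta1 (x : Fin 5 → ℝ) : ℝ := 1 - x 0
/-- `δ₂ = 1 − x₂ δ₁`. [cite: Fischler2002Polyzetas, §1 p. 2] -/
noncomputable def delta2 (x : Fin 5 → ℝ) : ℝ := 1 - x 1 * delta1 x
/-- `δ₃ = 1 − x₃ δ₂`. [cite: Fischler2002Polyzetas, §1 p. 2] -/
noncomputable def delta3 (x : Fin 5 → ℝ) : ℝ := 1 - x 2 * delta2 x
/-- `δ₄ = 1 − x₄ δ₃`. [cite: Fischler2002Polyzetas, §1 p. 2] -/
noncomputable def delta4 (x : Fin 5 → ℝ) : ℝ := 1 - x 3 * delta3 x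
/-- `δ₅ = 1 − x₅ δ₄`. [cite: Fischler2002Polyzetas, §1 p. 2] -/
noncomputable def delta5 (x : Fin 5 → ℝ) : ℝ := 1 - x 4 * delta4 x

/-- Parameters `p = (a_1,…,a_5, b_1,…,b_5, c_2,…,c_5) ∈ ℤ^{14}` (`a (k-1) = a_k`, `b (k-1) = b_k`, `c i = c_{i+2}`). [cite: Fischler2002Polyzetas, §3 p. 4] -/
structure Params where
  a : Fin 5 → ℤ
  b : Fin 5 → ℤ
  c : Fin 4 → ℤ

/-- The integrand of `𝒥(p)`: `∏_{k=1}^5 x_k^{a_k}(1−x_k)^{b_k} / (δ₂^{c₂} δ₃^{c₃} δ₄^{c₄} δ₅^{c₅} · δ₅)` (integer powers). [cite: Fischler2002Polyzetas, §3 p. 4] -/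
noncomputable def integrand (p : Params) (x : Fin 5 → ℝ) : ℝ :=
  (∏ k : Fin 5, x k ^ p.a k * (1 - x k) ^ p.b k) /
    (delta2 x ^ p.c 0 * delta3 x ^ p.c 1 * delta4 x ^ p.c 2 * delta5 x ^ p.c 3 * delta5 x)

/-- The closed unit cube `[0,1]^5`. [folklore] -/
def cube : Set (Fin 5 → ℝ) := Set.pi Set.univ fun _ : Fin 5 => Set.Icc (0 : ℝ) 1

/-- `𝒥(p)` (Lebesgue integral over the closed cube; junk value when not integrable). [cite: Fischler2002Polyzetas, §3 p. 4] -/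
noncomputable def J (p : Params) : ℝ := ∫ x in cube, integrand p x

/-- `ρ₅ = c₅ − b₅`. [cite: Fischler2002Polyzetas, §3 p. 4] -/
def rho5 (p : Params) : ℤ := p.c 3 - p.b 4
/-- `ρ₄ = c₄ − 1 − b₄`. [cite: Fischler2002Polyzetas, §3 p. 4] -/
def rho4 (p : Params) : ℤ := p.c 2 - 1 - p.b 3
/-- `ρ₃ = ρ₅⁺ + c₃ − 1 − b₃`. [cite: Fischler2002Polyzetas, §3 p. 4] -/
def rho3 (p : Params) : ℤ := max (rho5 p) 0 + p.c 1 - 1 - p.b 2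
/-- `ρ₂ = ρ₄⁺ + c₂ − 1 − b₂`. [cite: Fischler2002Polyzetas, §3 p. 4] -/
def rho2 (p : Params) : ℤ := max (rho4 p) 0 + p.c 0 - 1 - p.b 1
/-- `ρ₁ = ρ₃⁺ + c₁ − 1 − b₁` with the convention `c₁ = 1`. [cite: Fischler2002Polyzetas, §3 p. 4] -/
def rho1 (p : Params) : ℤ := max (rho3 p) 0 + 1 - 1 - p.b 0

/-- Fischler's finiteness criterion: `a_k ≥ 0`, `b_k ≥ 0` and `ρ_k ≤ a_{k−1}` for `k = 1,…,5` (`a₀ := 0`). [cite: Fischler2002Polyzetas, §3 p. 4] -/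
def FinitenessCriterion (p : Params) : Prop :=
  (∀ k, 0 ≤ p.a k) ∧ (∀ k, 0 ≤ p.b k) ∧
    rho1 p ≤ 0 ∧ rho2 p ≤ p.a 0 ∧ rho3 p ≤ p.a 1 ∧ rho4 p ≤ p.a 2 ∧ rho5 p ≤ p.a 3

/-- **Fischler 2002, §3** (named fact, statement only, `n = 5`): the integral `𝒥(p)` is finite if and only if
`a_k ≥ 0`, `b_k ≥ 0` and `ρ_k ≤ a_{k−1}` for all `k` — rendered as Lebesgue integrability of the integrand on `[0,1]^5`.
[cite: Fischler2002Polyzetas, §3 p. 4 (critère de finitude de 𝒥(p)), specialised to n = 5; proofs in Fischler2003RhinViola = J. Théor. Nombres Bordeaux 15 (2003) 479–534] -/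
def integralJ_finite_iff : Prop :=
  ∀ p : Params, IntegrableOn (integrand p) cube ↔ FinitenessCriterion p

end Literature.NumberTheory.Irrationality.Fischler2002
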